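import Literature.NumberTheory.GaloisRepresentations.ContinuousCohomologyNineTerm
import Literature.NumberTheory.GaloisRepresentations.PPrimaryDevissage
import Mathlib.GroupTheory.SpecificGroups.Cyclic
import HarnessLib

/-!
# Route `ByReductionTypeAtTwo`, item `OrdKatoHalfAtTwo` (stmt-BirchSwinnertonDyer-19271), TOWER road, the
# GOOD-ORDINARY local tower kernels at `v ∣ 2` at FULL `2`-power depth: BRICK C — the Euler–Poincaré count for a cyclic
# `2`-power module by dévissage from its order-`2` constituents (pure continuous cohomology)

HONEST FRAMING (cell `bsd-2adic`, run/shared/lean/pub/bsd-2adic/, seat `bsd-2adic-tower-1` GEN 20, HUMAN RULINGS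
D-0036 / D-0054 / D-0074): TOOL theorems only (no definition, no named fact, no `sorry`); closes nothing by itself;
nothing booked; BSD is not proved by any of this. Brick C of the programme «UNIFORM layer bound
`∃ C, ∀ n, #𝒦_{v,n}[2^∞] ≤ C` at a good ordinary `2` over `ℚ`» ⇒ `WeierstrassCurve.Greenberg1999_kerG_bounded` at `p = 2`
⇒ Mazur's control theorem `WeierstrassCurve.selmer_control` over `ℚ` at `p = 2` (Greenberg, LNM 1716, Thm. 1.2). It is
the depth-`2^k` form of GEN 11's BRICK G5 (`…GoodOrdTowerEPTower.lean`: `#H¹(H_n, μ₂) = 2^{2^n+2}`, `#H² = 2`): the local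
Euler–Poincaré characteristic of the layer group `H_n` on the formal-group torsion `Ê[2^k]` (a CYCLIC group of order
`2^k` with a NON-trivial Galois action for `k ≥ 2`). The point of `p = 2`: every constituent `Ê[2^{j+1}]/Ê[2^j]` has
order `2`, hence TRIVIAL action, so the count follows from the order-`2` case by the tree's nine-term dévissage
(`IsSES.card_nineTerm`, Milne ADT I Thm. 2.8 «both sides are additive in M») — no Tate formula for twisted coefficients is
needed (which is what blocks odd `p`).

* `finite_and_natCard_one_eq_of_isAddCyclic_two_pow` — for a compact group `G` with `H³(G, V) = 0` on `2`-torsion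
  discrete `V`, and a constant `N` such that `#H¹(G, V) = N · #V^G · #H²(G, V)` (all finite) for every discrete `G`-module
  `V` of order `2`: for every discrete `G`-module `M` which is a CYCLIC group of order `2^k`, `H¹(G, M)` and `H²(G, M)` are
  finite and `#H¹(G, M) = N^k · #M^G · #H²(G, M)`. (Applied with `G = H_n`, `N = 2^{2^n}` from BRICK G5.)

References: J. Milne, *Arithmetic Duality Theorems* (2006), I Thm. 2.8 (proof); J.-P. Serre, *Galois Cohomology* (1997),
I §3.3, II §5.4, II §5.7.
-/

set_option autoImplicit false
-- the Theorems namespace of this sub repeats the summit name by design (D-0017 nested layout: Summit.<S>.<Sub>)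
set_option linter.dupNamespace false

noncomputable section

open scoped Classical

universe u

namespace Summit.BirchSwinnertonDyer.BirchSwinnertonDyer.Theorems.GoodOrdTower

open CategoryTheory Literature.NumberTheory.GaloisRepresentations _root_.TopRep _root_.ContRepresentation
  _root_.ContinuousCohomology

/-! ### Finite-group bookkeeping -/

/-- The middle term of an exact sequence `α → β → γ` with finite ends is finite. [folklore] -/
private theorem finite_of_exact {α β γ : Type*} [AddCommGroup α] [AddCommGroup β] [AddCommGroup γ]
    [Finite α] [Finite γ] (φ : α →+ β) (ψ : β →+ γ) (h : ∀ b, ψ b = 0 → ∃ a, φ a = b) : Finite β := by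
  have hker : ψ.ker ≤ φ.range := fun b hb ↦ h b ((AddMonoidHom.mem_ker).mp hb)
  haveI : Finite φ.range := Finite.of_surjective φ.rangeRestrict φ.rangeRestrict_surjective
  haveI : Finite ψ.ker := Finite.of_injective _ (AddSubgroup.inclusion_injective hker)
  haveI : Finite (β ⧸ ψ.ker) := Finite.of_equiv _ (QuotientAddGroup.quotientKerEquivRange ψ).toEquiv.symm
  apply Nat.finite_of_card_ne_zero
  rw [AddSubgroup.card_eq_card_quotient_mul_card_addSubgroup ψ.ker]
  exact mul_ne_zero (Nat.card_pos (α := β ⧸ ψ.ker)).ne' (Nat.card_pos (α := ψ.ker)).ne'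

/-- In a finite cyclic additive group the elements killed by `2` number at most `2`. [folklore] -/
private theorem natCard_two_nsmul_eq_zero_le {M : Type u} [AddCommGroup M] [Finite M] [IsAddCyclic M] :
    Nat.card {x : M // (2 : ℕ) • x = 0} ≤ 2 := by
  let H : AddSubgroup M := AddSubgroup.torsionBy M (2 : ℤ)
  have hH : ∀ x : M, x ∈ H ↔ (2 : ℕ) • x = 0 := fun x ↦ AddSubgroup.torsionBy.nsmul_iff
  have hcard : Nat.card {x : M // (2 : ℕ) • x = 0} = Nat.card H :=
    Nat.card_congr (Equiv.subtypeEquivRight fun x ↦ (hH x).symm)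
  haveI : IsAddCyclic H := AddSubgroup.isAddCyclic H
  have hexp : AddMonoid.exponent H ∣ 2 :=
    AddMonoid.exponent_dvd_of_forall_nsmul_eq_zero fun x ↦ Subtype.ext (by
      rw [AddSubgroup.coe_nsmul, AddSubgroup.coe_zero]; exact (hH x.1).mp x.2)
  rw [hcard, ← IsAddCyclic.exponent_eq_card]
  exact Nat.le_of_dvd two_pos hexp

/-- **In a cyclic group of order `2^{k+1}` with a `G`-action, an element of order `2` exists and is FIXED** (it is the
unique element of order `2`). [folklore] -/
private theorem exists_addOrderOf_two_fixed {G : Type u} [Group G] [TopologicalSpace G]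
    {M : Type u} [AddCommGroup M] [TopologicalSpace M] [Finite M] [IsAddCyclic M]
    (ρ : ContinuousRep G ℤ M) {k : ℕ} (hM : Nat.card M = 2 ^ (k + 1)) :
    ∃ b : M, b ≠ 0 ∧ (2 : ℕ) • b = 0 ∧ ∀ g : G, ρ g b = b := by
  haveI : Fact (Nat.Prime 2) := ⟨Nat.prime_two⟩
  letI := Fintype.ofFinite M
  have hdvd : 2 ∣ Fintype.card M := by
    rw [Fintype.card_eq_nat_card, hM, pow_succ]; exact dvd_mul_left 2 _
  obtain ⟨b, hb⟩ := exists_prime_addOrderOf_dvd_card 2 hdvd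
  have hb0 : b ≠ 0 := fun h ↦ by rw [h, addOrderOf_zero] at hb; exact absurd hb (by norm_num)
  have hb2 : (2 : ℕ) • b = 0 := by rw [← hb]; exact addOrderOf_nsmul_eq_zero b
  refine ⟨b, hb0, hb2, fun g ↦ ?_⟩
  -- `ρ g b` is a non-zero `2`-torsion element, and there are at most two `2`-torsion elements
  have hgb2 : (2 : ℕ) • ρ g b = 0 := by rw [← map_nsmul, hb2, map_zero]
  have hinv : ∀ x : M, ρ g⁻¹ (ρ g x) = x := fun x ↦ by
    rw [← Module.End.mul_apply, ← map_mul, inv_mul_cancel, map_one, Module.End.one_apply]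
  have hinj : Function.Injective (ρ g) := fun x y hxy ↦ by
    have h := congrArg (ρ g⁻¹) hxy
    rwa [hinv, hinv] at h
  have hgb0 : ρ g b ≠ 0 := fun h ↦ hb0 (hinj (by rw [h, map_zero]))
  by_contra hne
  -- three distinct `2`-torsion elements `0, b, ρ g b`
  have h3 : 3 ≤ Nat.card {x : M // (2 : ℕ) • x = 0} := by
    let f : Fin 3 → {x : M // (2 : ℕ) • x = 0} :=
      ![⟨0, smul_zero _⟩, ⟨b, hb2⟩, ⟨ρ g b, hgb2⟩]
    have hf : Function.Injective f := by
      intro i j hij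
      fin_cases i <;> fin_cases j
      all_goals first
        | rfl
        | (exfalso
           have hv := congrArg Subtype.val hij
           simp only [f] at hv
           first
             | exact hb0 hv.symm
             | exact hb0 hv
             | exact hgb0 hv.symm
             | exact hgb0 hv
             | exact hne hv.symm
             | exact hne hv)
    have h := Nat.card_le_card_of_injective f hf
    rwa [Nat.card_eq_fintype_card, Fintype.card_fin] at h
  have h2 := natCard_two_nsmul_eq_zero_le (M := M)
  omega

/-! ### The dévissage count -/

/-- **One dévissage step, abstractly**: for a short exact sequence `0 → M₁ → M₂ → M₃ → 0` of discrete `G`-modules with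
`H³(G, M₁) = 0`, if `#H¹(M₁) = N · #M₁^G · #H²(M₁)` and `#H¹(M₃) = N^k · #M₃^G · #H²(M₃)` (all four groups finite), then
`H¹(M₂)`, `H²(M₂)` are finite and `#H¹(M₂) = N^{k+1} · #M₂^G · #H²(M₂)` — exactness of the nine-term sequence
(`IsSES.card_nineTerm`) and cancellation. [cite: MilneADT2006, I §2 Thm. 2.8 (proof)] -/
private theorem devissage_step {A : Type*} [CommRing A] [TopologicalSpace A]
    {G : Type u} [Group G] [TopologicalSpace G] [IsTopologicalGroup G] [LocallyCompactSpace G]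
    {M₁ : Type u} [AddCommGroup M₁] [Module A M₁] [TopologicalSpace M₁] [DiscreteTopology M₁]
    [ContinuousSMul A M₁]
    {M₂ : Type u} [AddCommGroup M₂] [Module A M₂] [TopologicalSpace M₂] [DiscreteTopology M₂]
    [ContinuousSMul A M₂]
    {M₃ : Type u} [AddCommGroup M₃] [Module A M₃] [TopologicalSpace M₃] [DiscreteTopology M₃]
    [ContinuousSMul A M₃]
    {ρ₁ : ContinuousRep G A M₁} {ρ₂ : ContinuousRep G A M₂} {ρ₃ : ContinuousRep G A M₃}
    {f : ρ₁.toTopRep ⟶ ρ₂.toTopRep} {g : ρ₂.toTopRep ⟶ ρ₃.toTopRep} (h : IsSES f g)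
    [Subsingleton (continuousCohomology 3 ρ₁.toTopRep)] [Finite M₁] [Finite M₂] [Finite M₃]
    (hf1₁ : Finite (continuousCohomology 1 ρ₁.toTopRep)) (hf2₁ : Finite (continuousCohomology 2 ρ₁.toTopRep))
    (hf1₃ : Finite (continuousCohomology 1 ρ₃.toTopRep)) (hf2₃ : Finite (continuousCohomology 2 ρ₃.toTopRep))
    (N k : ℕ)
    (h₁ : Nat.card (continuousCohomology 1 ρ₁.toTopRep) =
      N * Nat.card ρ₁.toTopRep.ρ.invariants * Nat.card (continuousCohomology 2 ρ₁.toTopRep))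
    (h₃ : Nat.card (continuousCohomology 1 ρ₃.toTopRep) =
      N ^ k * Nat.card ρ₃.toTopRep.ρ.invariants * Nat.card (continuousCohomology 2 ρ₃.toTopRep)) :
    Finite (continuousCohomology 1 ρ₂.toTopRep) ∧ Finite (continuousCohomology 2 ρ₂.toTopRep) ∧
      Nat.card (continuousCohomology 1 ρ₂.toTopRep) =
        N ^ (k + 1) * Nat.card ρ₂.toTopRep.ρ.invariants * Nat.card (continuousCohomology 2 ρ₂.toTopRep) := by
  haveI := hf1₁; haveI := hf2₁; haveI := hf1₃; haveI := hf2₃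
  -- finiteness of `H¹(M₂)`, `H²(M₂)` from exactness
  haveI hf1 : Finite (continuousCohomology 1 ρ₂.toTopRep) :=
    finite_of_exact (cohomologyMap f 1).hom.toLinearMap.toAddMonoidHom
      (cohomologyMap g 1).hom.toLinearMap.toAddMonoidHom fun y hy ↦ h.exists_map_one_eq_of_map_one_eq_zero y hy
  haveI hf2 : Finite (continuousCohomology 2 ρ₂.toTopRep) :=
    finite_of_exact (cohomologyMap f 2).hom.toLinearMap.toAddMonoidHom
      (cohomologyMap g 2).hom.toLinearMap.toAddMonoidHom fun y hy ↦ h.exists_map_two_eq_of_map_two_eq_zero y hy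
  refine ⟨hf1, hf2, ?_⟩
  have h9 := h.card_nineTerm
  rw [h₁, h₃] at h9
  haveI : Finite ρ₁.toTopRep.ρ.invariants := Finite.of_injective _ Subtype.val_injective
  haveI : Finite ρ₃.toTopRep.ρ.invariants := Finite.of_injective _ Subtype.val_injective
  have hpos : 0 < Nat.card ρ₁.toTopRep.ρ.invariants * Nat.card ρ₃.toTopRep.ρ.invariants *
      Nat.card (continuousCohomology 2 ρ₁.toTopRep) * Nat.card (continuousCohomology 2 ρ₃.toTopRep) :=
    Nat.mul_pos (Nat.mul_pos (Nat.mul_pos Nat.card_pos Nat.card_pos) Nat.card_pos) Nat.card_pos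
  refine Nat.eq_of_mul_eq_mul_right hpos ?_
  calc Nat.card (continuousCohomology 1 ρ₂.toTopRep) *
        (Nat.card ρ₁.toTopRep.ρ.invariants * Nat.card ρ₃.toTopRep.ρ.invariants *
          Nat.card (continuousCohomology 2 ρ₁.toTopRep) * Nat.card (continuousCohomology 2 ρ₃.toTopRep))
      = Nat.card ρ₁.toTopRep.ρ.invariants * Nat.card ρ₃.toTopRep.ρ.invariants *
          Nat.card (continuousCohomology 1 ρ₂.toTopRep) * Nat.card (continuousCohomology 2 ρ₁.toTopRep) *
          Nat.card (continuousCohomology 2 ρ₃.toTopRep) := by ring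
    _ = Nat.card ρ₂.toTopRep.ρ.invariants *
          (N * Nat.card ρ₁.toTopRep.ρ.invariants * Nat.card (continuousCohomology 2 ρ₁.toTopRep)) *
          (N ^ k * Nat.card ρ₃.toTopRep.ρ.invariants * Nat.card (continuousCohomology 2 ρ₃.toTopRep)) *
          Nat.card (continuousCohomology 2 ρ₂.toTopRep) := h9
    _ = N ^ (k + 1) * Nat.card ρ₂.toTopRep.ρ.invariants * Nat.card (continuousCohomology 2 ρ₂.toTopRep) *
        (Nat.card ρ₁.toTopRep.ρ.invariants * Nat.card ρ₃.toTopRep.ρ.invariants *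
          Nat.card (continuousCohomology 2 ρ₁.toTopRep) * Nat.card (continuousCohomology 2 ρ₃.toTopRep)) := by ring

set_option maxHeartbeats 800000 in
/-- **The Euler–Poincaré count of a cyclic `2`-power module from its order-`2` constituents.** Let `G` be a compact
(locally compact) topological group such that `H³(G, V) = 0` for every discrete `2`-torsion `G`-module `V`, and suppose there
is `N` with `#H¹(G, V) = N · #V^G · #H²(G, V)` (`H¹`, `H²` finite) for every discrete `G`-module `V` of ORDER `2`. Then
for every discrete `G`-module `M` whose underlying group is CYCLIC of order `2^k`: `H¹(G, M)` and `H²(G, M)` are finite and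
`#H¹(G, M) = N^k · #M^G · #H²(G, M)`. Proof by induction on `k` through `0 → M[2] → M → M/M[2] → 0` (the element of order
`2` of a cyclic `2`-group is unique, hence `G`-fixed; `M/M[2]` is cyclic of order `2^{k−1}`) and the nine-term count
`IsSES.card_nineTerm`. [cite: MilneADT2006, I §2 Thm. 2.8 (proof)] [cite: SerreGaloisCohomology1997, II §5.4] -/
theorem finite_and_natCard_one_eq_of_isAddCyclic_two_pow {G : Type u} [Group G] [TopologicalSpace G]
    [IsTopologicalGroup G] [CompactSpace G] [LocallyCompactSpace G]
    (h3 : ∀ (V : Type u) [AddCommGroup V] [TopologicalSpace V] [DiscreteTopology V] (τ : ContinuousRep G ℤ V),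
      (∀ x : V, (2 : ℕ) • x = 0) → Subsingleton (continuousCohomology 3 τ.toTopRep))
    (N : ℕ)
    (h1 : ∀ (V : Type u) [AddCommGroup V] [TopologicalSpace V] [DiscreteTopology V] [Finite V]
      (τ : ContinuousRep G ℤ V), Nat.card V = 2 →
        Finite (continuousCohomology 1 τ.toTopRep) ∧ Finite (continuousCohomology 2 τ.toTopRep) ∧
          Nat.card (continuousCohomology 1 τ.toTopRep) =
            N * Nat.card τ.toTopRep.ρ.invariants * Nat.card (continuousCohomology 2 τ.toTopRep))
    (k : ℕ) (M : Type u) [AddCommGroup M] [TopologicalSpace M] [DiscreteTopology M] [Finite M] [IsAddCyclic M]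
    (ρ : ContinuousRep G ℤ M) (hM : Nat.card M = 2 ^ k) :
    Finite (continuousCohomology 1 ρ.toTopRep) ∧ Finite (continuousCohomology 2 ρ.toTopRep) ∧
      Nat.card (continuousCohomology 1 ρ.toTopRep) =
        N ^ k * Nat.card ρ.toTopRep.ρ.invariants * Nat.card (continuousCohomology 2 ρ.toTopRep) := by
  haveI : Fact (Nat.Prime 2) := ⟨Nat.prime_two⟩
  induction k generalizing M with
  | zero =>
    -- `M = 0`
    rw [pow_zero] at hM
    haveI hsub : Subsingleton M := (Nat.card_eq_one_iff_unique.mp hM).1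
    haveI h1s : Subsingleton (continuousCohomology 1 ρ.toTopRep) :=
      subsingleton_continuousCohomology_of_subsingleton ρ.toTopRep 0
    haveI h2s : Subsingleton (continuousCohomology 2 ρ.toTopRep) :=
      subsingleton_continuousCohomology_of_subsingleton ρ.toTopRep 1
    refine ⟨Finite.of_subsingleton, Finite.of_subsingleton, ?_⟩
    rw [pow_zero, one_mul, Nat.card_of_subsingleton (0 : continuousCohomology 1 ρ.toTopRep),
      Nat.card_of_subsingleton (0 : continuousCohomology 2 ρ.toTopRep),
      Nat.card_of_subsingleton (0 : ρ.toTopRep.ρ.invariants)]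
  | succ k ih =>
    -- the fixed line `W = M[2] = {0, b}`
    obtain ⟨b, hb0, hb2, hbfix⟩ := exists_addOrderOf_two_fixed ρ hM
    let W : Submodule ℤ M := Submodule.span ℤ {b}
    have hW : ∀ g, W ≤ W.comap (ρ g) := span_singleton_le_comap ρ b hbfix
    have hSES := isSES_subtype_mkQ ρ W hW
    have hcardW : Nat.card W = 2 := natCard_span_singleton b hb0 hb2
    -- the quotient: cyclic of order `2^k`
    haveI : Finite (M ⧸ W) := Finite.of_surjective _ (Submodule.Quotient.mk_surjective W)
    haveI : IsAddCyclic (M ⧸ W) := isAddCyclic_of_surjective W.mkQ (Submodule.mkQ_surjective W)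
    have hcardQ : Nat.card (M ⧸ W) = 2 ^ k := by
      have hmul : Nat.card M = Nat.card (M ⧸ W) * Nat.card W :=
        AddSubgroup.card_eq_card_quotient_mul_card_addSubgroup W.toAddSubgroup
      rw [hM, hcardW, pow_succ] at hmul
      exact (Nat.eq_of_mul_eq_mul_right two_pos hmul).symm
    -- the sub and the quotient representation
    haveI : Finite W := Finite.of_injective _ Subtype.val_injective
    obtain ⟨hf1W, hf2W, hW1⟩ := h1 W (ρ.subrepresentation W hW) hcardW
    obtain ⟨hf1Q, hf2Q, hQ1⟩ := ih (M ⧸ W) (ρ.quotient W hW) hcardQ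
    haveI h3W : Subsingleton (continuousCohomology 3 (ρ.subrepresentation W hW).toTopRep) :=
      h3 W (ρ.subrepresentation W hW) fun x ↦ Subtype.ext (by
        rw [AddSubmonoidClass.coe_nsmul, ZeroMemClass.coe_zero]
        obtain ⟨a, ha⟩ := Submodule.mem_span_singleton.mp x.2
        rw [← ha, smul_comm, hb2, smul_zero])
    exact devissage_step hSES hf1W hf2W hf1Q hf2Q N k hW1 hQ1

end Summit.BirchSwinnertonDyer.BirchSwinnertonDyer.Theorems.GoodOrdTower

end
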